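import Summits.CriticalPhenomena.Ising3DConformalLimit.Theses.FKParityRobustness
import Summits.CriticalPhenomena.Ising3DConformalLimit.Theorems.FKParityRobustnessIndependentStrandsJoinPinchToTetraDefs
import Summits.CriticalPhenomena.Ising3DConformalLimit.Theorems.FKParityRobustnessLatticeBoundFromStrands
import Summits.CriticalPhenomena.Ising3DConformalLimit.Theorems.FKParityRobustnessFarMergingGivesU4
import Summits.CriticalPhenomena.Ising3DConformalLimit.Theorems.FKParityRobustnessIndependentStrandsJoinStubTransfer
import Summits.CriticalPhenomena.Ising3DConformalLimit.Theorems.FKParityRobustnessIndependentStrandsJoinStubSeparation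
import Summits.CriticalPhenomena.Ising3DConformalLimit.Theorems.FKParityRobustnessIndependentStrandsJoinStubSymmetry
import Summits.CriticalPhenomena.Ising3DConformalLimit.Theorems.FKParityRobustnessIndependentStrandsJoinStubBoxSymmetry
import Summits.CriticalPhenomena.Ising3DConformalLimit.Theorems.FKParityRobustnessIndependentStrandsJoinStubPairSplit
import Summits.CriticalPhenomena.Ising3DConformalLimit.Theorems.FKParityRobustnessDepletionBound
import Summits.CriticalPhenomena.Ising3DConformalLimit.Theorems.FKParityRobustnessDepletionBoundHTE
import Summits.CriticalPhenomena.Ising3DConformalLimit.Theorems.FKParityRobustnessDefs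
import Summits.CriticalPhenomena.Ising3DConformalLimit.Theorems.FKParityRobustnessStrandsJoinBound
import Literature.Probability.LatticeModels.HighDimPointwiseTriviality
import Literature.Probability.LatticeModels.CriticalTwoPointBounds
import Summits.CriticalPhenomena.Ising3DConformalLimit.Theorems.IsingEuclidUpgradeR4NonGaussianFatStep
import HarnessLib

/-!
# `IndependentStrandsJoin` ⟸ `LimitExists ∧ TetraMergingIO ∧ IndependentStrandsJoinPerScale` — the composition of the
# limit upgrade with the box passage and the landed tetrahedral sandwich (registered sub-goal `stub_limitUpgrade`)
(crux item stmt-CriticalPhenomena-14625, route `FKParityRobustness`; lines `limit-upgrade-io` ⊂ `pinch-to-tetra` of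
`Cruxes/IndependentStrandsJoin/Lines/`; crux strategist p1's candidate `independentStrandsJoin_of_limit_io`, landed by the
lead `prover-line-stmt-CriticalPhenomena-14625-c2-0`, 2026-08-17; `--supports stmt-CriticalPhenomena-14625`)

Theorem-only file over the line vocabulary `…PinchToTetraDefs` (`U4crit`, `GGcrit`, `LimitExists`, `TetraMergingIO`,
`TetraMergingEventually`, `IndependentStrandsJoinPerScale`, and the limit upgrade `tetraMergingEventually_of_io`).
Results (axioms `propext`, `Classical.choice`, `Quot.sound`):
* `boxU4Bound_of_critical` — a strict-margin tetrahedral bound `U₄^crit(l·A) ≤ -c·GG` in the critical state passes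
  to all large FREE BOXES `Λ_N` with constant `c/2` (`criticalCorr_wellDefined_holds`: the free-box correlators converge
  to the critical state; `GG > 0` by the landed `criticalCorr_two_pos'`);
* `jointSum_ge_of_boxU4` — per box, the landed sandwich of line `Sketch` (`StubTransfer.joint_ge_of_sep_sym_u4` with
  `stub_separation ∘ depletionBound_proof ∘ stub_pairSplit`, `stub_symmetry`, `stub_boxSymmetry`) turns a box `U₄`
  bound with constant `c` into the crux's joint loop-O(1) inequality with constant `c/3`;
* `independentStrandsJoin_of_limit_io : LimitExists → TetraMergingIO → IndependentStrandsJoinPerScale →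
  IndependentStrandsJoin` — the composition: the limit upgrade gives the tetrahedral bound at all scales `l ≥ l₁`,
  the finitely many scales `1 ≤ l < l₁` carry their own per-scale constants (`IndependentStrandsJoinPerScale`, landed
  as `Theorems.stub_perScale`), and the crux's constant is the finite minimum; re-exported as the registered sub-goal
  `Theorems.stub_limitUpgrade`;
* calibration (the hypotheses do not over-shoot): `limitExists_of_moebiusLimit : MoebiusLimit → LimitExists`,
  `tetraMergingIO_of_independentStrandsJoin : IndependentStrandsJoin → TetraMergingIO`,
  `perScale_of_independentStrandsJoin : IndependentStrandsJoin → IndependentStrandsJoinPerScale`.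

Upshot (strategist census p1, O1): modulo the route's own rank-4 crux `MoebiusLimit` (⊇ `LimitExists`) and the landed
per-scale statement, the rank-2 crux is EQUIVALENT to its `∃^∞ l` weakening `TetraMergingIO` — the output form of every
multi-scale / scale-pigeonhole argument.  Nothing here claims `LimitExists` or `TetraMergingIO`.

References: M. Aizenman, Comm. Math. Phys. 86 (1982) Prop. 5.3 [AizenmanCMP1982]; M. Aizenman, H. Duminil-Copin,
V. Sidoravicius, Comm. Math. Phys. 334 (2015) [AizenmanDuminilCopinSidoraviciusCMP2015]; S. Friedli, Y. Velenik 2017,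
§3.7.3 [FriedliVelenik2017].
-/

noncomputable section

open Filter Topology Finset
open Literature.Probability.LatticeModels
open Summit.CriticalPhenomena.Ising3DConformalLimit.Theses.FKParityRobustness
open Summit.CriticalPhenomena.Ising3DConformalLimit.FKParityRobustnessFarMergingGivesU4
  (injective_vecCons_pair injective_toLp_intCast latticeApprox_inv_natCast)
open Summit.CriticalPhenomena.Ising3DConformalLimit.FKParityRobustnessLatticeBoundFromStrands
  (connectedFour_boxComap twoPoint_boxComap nPoint_boxComap smul_tetra_mem_box
   twoPoint_eq_loopO1_div twoPoint_eq_isingExpect_spinMonomial)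
open Summit.CriticalPhenomena.Ising3DConformalLimit.Cruxes.ParityRobustMerging.PlaquetteXorSurgery
  (tetra tetra_inj tetra_injective tanh_criticalBeta_nonneg)
open Summit.CriticalPhenomena.Ising3DConformalLimit.Cruxes.IsingEuclidUpgradeR4NonGaussian.FreeCovarianceDeltaDichotomy
  (criticalCorr_two_pos')

namespace Summit.CriticalPhenomena.Ising3DConformalLimit.Cruxes.IndependentStrandsJoin.PinchToTetra

/-! ## Step 2 — infinite volume ⇒ free boxes (per scale) -/

/-- The free pair correlation `isingCorr G univ β 0 free {x,y}` of a finite graph is its two-point function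
`twoPoint (isingMeasure G univ β 0 free) spinAt x y` (`x ≠ y`): both are `Z^{xy}_t/Z^∅_t`. [folklore] -/
theorem isingCorr_pair_eq_twoPoint {V : Type*} [Fintype V] [DecidableEq V] (G : SimpleGraph V)
    [DecidableRel G.Adj] {β : ℝ} (hβ : 0 ≤ β) {x y : V} (hxy : x ≠ y) :
    isingCorr G Finset.univ β 0 .free {x, y} = twoPoint (isingMeasure G Finset.univ β 0 .free) spinAt x y := by
  classical
  rw [twoPoint_eq_loopO1_div hβ hxy, isingCorr_free_eq_hteSum_div G Finset.univ β (Finset.subset_univ _),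
    ← Summit.CriticalPhenomena.Ising3DConformalLimit.Theorems.DepletionBound.loopO1PartitionFunction_eq_hteSum,
    ← Summit.CriticalPhenomena.Ising3DConformalLimit.Theorems.DepletionBound.loopO1PartitionFunction_eq_hteSum]

/-- **Infinite volume ⇒ boxes.**  A STRICT-margin tetrahedral bound in the critical state at scale `l`,
`U₄^crit(l·A) ≤ -c·GG` with `c > 0`, passes to all large free boxes `Λ_N` with constant `c/2`: the free box
correlators converge to the critical state (`criticalCorr_wellDefined_holds`) and `GG > 0`. [folklore] -/
theorem boxU4Bound_of_critical {c : ℝ} (hc : 0 < c) {l : ℕ} (hl : 1 ≤ l) (h : U4crit l ≤ -(c * GGcrit l)) :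
    ∃ N₀ : ℕ, ∀ N : ℕ, N₀ ≤ N → ∀ a : Fin 4 → ↥(box 3 N), (∀ i, ((a i : Site 3)) = (l : ℤ) • tetra i) →
      connectedFour (isingMeasure ((zdGraph 3).comap (Subtype.val : ↥(box 3 N) → Site 3)) Finset.univ
          (criticalBeta 3) 0 .free) spinAt a
        ≤ -(c / 2 * isingCorr ((zdGraph 3).comap (Subtype.val : ↥(box 3 N) → Site 3)) Finset.univ
              (criticalBeta 3) 0 .free {a 0, a 1} *
            isingCorr ((zdGraph 3).comap (Subtype.val : ↥(box 3 N) → Site 3)) Finset.univ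
              (criticalBeta 3) 0 .free {a 2, a 3}) := by
  have hβ : 0 ≤ criticalBeta 3 := criticalBeta_nonneg 3
  -- the free box correlators at the points `l·A`
  set u : ℕ → ℝ := fun N => isingExpect (zdGraph 3) (box 3 N) (criticalBeta 3) 0 .free
    (spinMonomial fun i : Fin 4 => (l : ℤ) • tetra i) with hu
  set g : ℕ → Fin 4 → Fin 4 → ℝ := fun N i j => isingExpect (zdGraph 3) (box 3 N) (criticalBeta 3) 0 .free
    (spinMonomial ![(l : ℤ) • tetra i, (l : ℤ) • tetra j]) with hg
  have hwd := criticalCorr_wellDefined_holds (d := 3) le_rfl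
  have hfree : (BoundaryCondition.free : BoundaryCondition (Site 3)) ∈
      ({.free, .plus, .minus} : Set (BoundaryCondition (Site 3))) := by simp
  have hu' : Tendsto u atTop (𝓝 (criticalCorr 3 4 fun i : Fin 4 => (l : ℤ) • tetra i)) :=
    hwd 4 (fun i : Fin 4 => (l : ℤ) • tetra i) .free hfree
  have hg' : ∀ i j : Fin 4, Tendsto (fun N => g N i j) atTop (𝓝 (criticalCorr 3 2 ![(l : ℤ) • tetra i, (l : ℤ) • tetra j])) :=
    fun i j => hwd 2 ![(l : ℤ) • tetra i, (l : ℤ) • tetra j] .free hfree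
  -- the margin functional converges to a negative number
  have hD : Tendsto (fun N => u N - (g N 0 1 * g N 2 3 + g N 0 2 * g N 1 3 + g N 0 3 * g N 1 2)
      + c / 2 * (g N 0 1 * g N 2 3)) atTop (𝓝 (U4crit l + c / 2 * GGcrit l)) := by
    simp only [U4crit, GGcrit]
    exact (hu'.sub ((((hg' 0 1).mul (hg' 2 3)).add ((hg' 0 2).mul (hg' 1 3))).add ((hg' 0 3).mul (hg' 1 2)))).add
      (((hg' 0 1).mul (hg' 2 3)).const_mul (c / 2))
  have hGG : 0 < GGcrit l := mul_pos (criticalCorr_two_pos' _ _) (criticalCorr_two_pos' _ _)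
  have hneg : U4crit l + c / 2 * GGcrit l < 0 := by nlinarith
  obtain ⟨N₁, hN₁⟩ := Filter.eventually_atTop.1 (hD.eventually (gt_mem_nhds hneg))
  refine ⟨max N₁ l, fun N hN a ha => ?_⟩
  have hN₁N : N₁ ≤ N := le_of_max_le_left hN
  have hainj : Function.Injective a := tetra_injective hl a ha
  -- transport to the free box measure of `ℤ³` and read everything as `isingExpect` of spin monomials
  rw [isingCorr_pair_eq_twoPoint _ hβ (hainj.ne (by decide)), isingCorr_pair_eq_twoPoint _ hβ (hainj.ne (by decide)),
    connectedFour_boxComap (box 3 N) (criticalBeta 3) a, twoPoint_boxComap (box 3 N) (criticalBeta 3) (a 0) (a 1),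
    twoPoint_boxComap (box 3 N) (criticalBeta 3) (a 2) (a 3)]
  unfold connectedFour
  rw [nPoint_isingMeasure]
  simp only [twoPoint_eq_isingExpect_spinMonomial, ha]
  have key := hN₁ N hN₁N
  simp only [hu, hg] at key
  linarith

/-! ## Step 3 — per box: the landed tetrahedral sandwich (`TetraU4Lattice ⇒ crux`, constant `c/3`) -/

/-- The landed separation bound of the line `Sketch` (DepletionBound + pair split), as a closed theorem. -/
theorem separation_bound :
    ∀ (V : Type) [Fintype V] [DecidableEq V] (G : SimpleGraph V) [DecidableRel G.Adj] (β : ℝ),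
      0 ≤ β → ∀ a : Fin 4 → V, Function.Injective a →
      loopO1PartitionFunction G (Real.tanh β) {a 0, a 1} * loopO1PartitionFunction G (Real.tanh β) {a 2, a 3}
        - (∑ F₁ ∈ tJoins G Set.univ {a 0, a 1}, ∑ F₂ ∈ tJoins G Set.univ {a 2, a 3},
            if ∃ v : V, (SimpleGraph.fromEdgeSet (↑F₁ : Set (Sym2 V))).Reachable (a 0) v ∧
                (SimpleGraph.fromEdgeSet (↑F₂ : Set (Sym2 V))).Reachable (a 2) v
            then Real.tanh β ^ (F₁.card + F₂.card) else 0)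
        ≤ (∑ D ∈ (tJoins G Set.univ (Finset.univ.image a)).filter (fun D : Finset (Sym2 V) =>
            ¬ (SimpleGraph.fromEdgeSet (↑D : Set (Sym2 V))).Reachable (a 0) (a 2) ∧
            ¬ (SimpleGraph.fromEdgeSet (↑D : Set (Sym2 V))).Reachable (a 0) (a 3)),
            Real.tanh β ^ D.card) * loopO1PartitionFunction G (Real.tanh β) ∅ :=
  Summit.CriticalPhenomena.Ising3DConformalLimit.Theorems.stub_separation
    Summit.CriticalPhenomena.Ising3DConformalLimit.Theorems.depletionBound_proof
    Summit.CriticalPhenomena.Ising3DConformalLimit.Theorems.stub_pairSplit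

set_option maxHeartbeats 400000 in
/-- **Per-box transfer** at one scale `l` and one box `Λ_N`: a tetrahedral `U₄` bound with constant `c` in
the box gives the crux's joint-sum inequality with constant `c/3` in the same box (landed algebra
`StubTransfer.joint_ge_of_sep_sym_u4` + landed separation, pairing symmetry and box symmetry). [folklore] -/
theorem jointSum_ge_of_boxU4 {c : ℝ} {l N : ℕ} (hl : 1 ≤ l) (a : Fin 4 → ↥(box 3 N))
    (ha : ∀ i, ((a i : Site 3)) = (l : ℤ) • tetra i)
    (hU : connectedFour (isingMeasure ((zdGraph 3).comap (Subtype.val : ↥(box 3 N) → Site 3)) Finset.univ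
          (criticalBeta 3) 0 .free) spinAt a
        ≤ -(c * isingCorr ((zdGraph 3).comap (Subtype.val : ↥(box 3 N) → Site 3)) Finset.univ
              (criticalBeta 3) 0 .free {a 0, a 1} *
            isingCorr ((zdGraph 3).comap (Subtype.val : ↥(box 3 N) → Site 3)) Finset.univ
              (criticalBeta 3) 0 .free {a 2, a 3})) :
    c / 3 * loopO1PartitionFunction ((zdGraph 3).comap (Subtype.val : ↥(box 3 N) → Site 3))
        (Real.tanh (criticalBeta 3)) {a 0, a 1} *
      loopO1PartitionFunction ((zdGraph 3).comap (Subtype.val : ↥(box 3 N) → Site 3))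
        (Real.tanh (criticalBeta 3)) {a 2, a 3} ≤
      ∑ F₁ ∈ tJoins ((zdGraph 3).comap (Subtype.val : ↥(box 3 N) → Site 3)) Set.univ {a 0, a 1},
        ∑ F₂ ∈ tJoins ((zdGraph 3).comap (Subtype.val : ↥(box 3 N) → Site 3)) Set.univ {a 2, a 3},
          if (SimpleGraph.fromEdgeSet ((↑F₁ : Set (Sym2 ↥(box 3 N))) ∪ ↑F₂)).Reachable (a 0) (a 2)
          then Real.tanh (criticalBeta 3) ^ (F₁.card + F₂.card) else 0 := by
  have hβ : 0 ≤ criticalBeta 3 := criticalBeta_nonneg 3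
  have ha' : Function.Injective a := tetra_injective hl a ha
  obtain ⟨hφ, hψ⟩ := Summit.CriticalPhenomena.Ising3DConformalLimit.Theorems.stub_boxSymmetry l N a ha
  have hS := Summit.CriticalPhenomena.Ising3DConformalLimit.Theorems.stub_symmetry ↥(box 3 N)
    ((zdGraph 3).comap (Subtype.val : ↥(box 3 N) → Site 3)) (Real.tanh (criticalBeta 3))
    tanh_criticalBeta_nonneg a ha' hφ hψ
  have hP := separation_bound ↥(box 3 N) ((zdGraph 3).comap (Subtype.val : ↥(box 3 N) → Site 3))
    (criticalBeta 3) hβ a ha'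
  -- the landed algebra; instance arguments are unified from the hypotheses (`@` + `convert`: the landed
  -- files elaborate `Decidable` instances classically, this file constructively — propositionally equal)
  have key := @Summit.CriticalPhenomena.Ising3DConformalLimit.Theorems.StubTransfer.joint_ge_of_sep_sym_u4
    ↥(box 3 N) _ _ ((zdGraph 3).comap (Subtype.val : ↥(box 3 N) → Site 3)) _ (criticalBeta 3) c hβ a ha'
  have key2 := key (by convert hP) (by convert hS) (by convert hU)
  convert key2

/-! ## Calibration (kernel-checked; not used by the composition)

`LimitExists` is implied by the route's rank-4 crux `MoebiusLimit`; `TetraMergingIO` and the per-scale statement are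
implied by the crux itself, so no hypothesis of the composition over-shoots the crux on the tetrahedral side. -/

/-- `MoebiusLimit → LimitExists` (forget `Δ` and the covariance). [folklore] -/
theorem limitExists_of_moebiusLimit (h : MoebiusLimit) : LimitExists := by
  obtain ⟨ρ, Δ, S, hρ, _, hlim, hnd, _⟩ := h
  exact ⟨ρ, S, hρ, hlim, hnd⟩

/-- `IndependentStrandsJoin → TetraMergingIO`: the crux gives the tetrahedral bound at every scale
(`latticeBoundFromStrands_proof` with the proved `StrandsJoinBound`), a fortiori infinitely often. [folklore] -/
theorem tetraMergingIO_of_independentStrandsJoin (h : IndependentStrandsJoin) : TetraMergingIO := by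
  obtain ⟨c, hc, hall⟩ :=
    Summit.CriticalPhenomena.Ising3DConformalLimit.FKParityRobustnessLatticeBoundFromStrands.latticeBoundFromStrands_proof
      h Summit.CriticalPhenomena.Ising3DConformalLimit.FKParityRobustnessStrandsJoinBound.strandsJoinBound_proof
  refine ⟨c, hc, fun L₀ => ⟨max L₀ 1, le_max_left _ _, ?_⟩⟩
  have := hall (max L₀ 1) (le_max_right _ _)
  simpa [U4crit, GGcrit, tetra] using this

/-- The crux trivially implies its per-scale form (the converse is exactly the open `l`-uniformity). [folklore] -/
theorem perScale_of_independentStrandsJoin (h : IndependentStrandsJoin) : IndependentStrandsJoinPerScale := by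
  obtain ⟨c, hc, hall⟩ := h
  intro l hl
  refine ⟨c, hc, ?_⟩
  simpa [tetra] using hall l hl

/-! ## Composition: the crux BY NAME from the three hypotheses -/

/-- **The line's composition.**  Existence of the limit (`LimitExists`) upgrades tetrahedral far merging along
infinitely many scales (`TetraMergingIO`) to all large scales `l ≥ l₁` (`tetraMergingEventually_of_io`); the
infinite-volume bound passes to large free boxes (`boxU4Bound_of_critical`) and, per box, to the crux's
joint loop-O(1) sum with constant `c/12` (`jointSum_ge_of_boxU4`); the finitely many scales `1 ≤ l < l₁`
carry their own positive constants (`IndependentStrandsJoinPerScale`); the crux's constant is the minimum. [folklore] -/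
theorem independentStrandsJoin_of_limit_io :
    LimitExists → TetraMergingIO → IndependentStrandsJoinPerScale →
      Summit.CriticalPhenomena.Ising3DConformalLimit.Theses.FKParityRobustness.IndependentStrandsJoin := by
  intro hL hio hper
  obtain ⟨c, hc, l₁, hev⟩ := tetraMergingEventually_of_io hL hio
  -- per-scale constants below `l₁`
  have hper' : ∀ l : ℕ, 1 ≤ l → ∃ c' : ℝ, 0 < c' ∧ ∃ N₀ : ℕ, ∀ N : ℕ, N₀ ≤ N → ∀ a : Fin 4 → ↥(box 3 N),
      (∀ i, ((a i : Site 3)) = (l : ℤ) • tetra i) →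
      c' * loopO1PartitionFunction ((zdGraph 3).comap (Subtype.val : ↥(box 3 N) → Site 3))
          (Real.tanh (criticalBeta 3)) {a 0, a 1} *
        loopO1PartitionFunction ((zdGraph 3).comap (Subtype.val : ↥(box 3 N) → Site 3))
          (Real.tanh (criticalBeta 3)) {a 2, a 3} ≤
        ∑ F₁ ∈ tJoins ((zdGraph 3).comap (Subtype.val : ↥(box 3 N) → Site 3)) Set.univ {a 0, a 1},
          ∑ F₂ ∈ tJoins ((zdGraph 3).comap (Subtype.val : ↥(box 3 N) → Site 3)) Set.univ {a 2, a 3},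
            if (SimpleGraph.fromEdgeSet ((↑F₁ : Set (Sym2 ↥(box 3 N))) ∪ ↑F₂)).Reachable (a 0) (a 2)
            then Real.tanh (criticalBeta 3) ^ (F₁.card + F₂.card) else 0 := hper
  -- large scales: constant `c/2/3`
  have hlarge : ∀ l : ℕ, 1 ≤ l → l₁ ≤ l → ∃ N₀ : ℕ, ∀ N : ℕ, N₀ ≤ N → ∀ a : Fin 4 → ↥(box 3 N),
      (∀ i, ((a i : Site 3)) = (l : ℤ) • tetra i) →
      c / 2 / 3 * loopO1PartitionFunction ((zdGraph 3).comap (Subtype.val : ↥(box 3 N) → Site 3))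
          (Real.tanh (criticalBeta 3)) {a 0, a 1} *
        loopO1PartitionFunction ((zdGraph 3).comap (Subtype.val : ↥(box 3 N) → Site 3))
          (Real.tanh (criticalBeta 3)) {a 2, a 3} ≤
        ∑ F₁ ∈ tJoins ((zdGraph 3).comap (Subtype.val : ↥(box 3 N) → Site 3)) Set.univ {a 0, a 1},
          ∑ F₂ ∈ tJoins ((zdGraph 3).comap (Subtype.val : ↥(box 3 N) → Site 3)) Set.univ {a 2, a 3},
            if (SimpleGraph.fromEdgeSet ((↑F₁ : Set (Sym2 ↥(box 3 N))) ∪ ↑F₂)).Reachable (a 0) (a 2)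
            then Real.tanh (criticalBeta 3) ^ (F₁.card + F₂.card) else 0 := by
    intro l hl hl₁
    obtain ⟨N₀, hN₀⟩ := boxU4Bound_of_critical hc hl (hev l hl₁)
    exact ⟨N₀, fun N hN a ha => jointSum_ge_of_boxU4 hl a ha (hN₀ N hN a ha)⟩
  -- a non-dependent choice of per-scale constants (value `1` at the unused scale `l = 0`)
  have hper'' : ∀ l : ℕ, ∃ c' : ℝ, 0 < c' ∧ (1 ≤ l → ∃ N₀ : ℕ, ∀ N : ℕ, N₀ ≤ N → ∀ a : Fin 4 → ↥(box 3 N),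
      (∀ i, ((a i : Site 3)) = (l : ℤ) • tetra i) →
      c' * loopO1PartitionFunction ((zdGraph 3).comap (Subtype.val : ↥(box 3 N) → Site 3))
          (Real.tanh (criticalBeta 3)) {a 0, a 1} *
        loopO1PartitionFunction ((zdGraph 3).comap (Subtype.val : ↥(box 3 N) → Site 3))
          (Real.tanh (criticalBeta 3)) {a 2, a 3} ≤
        ∑ F₁ ∈ tJoins ((zdGraph 3).comap (Subtype.val : ↥(box 3 N) → Site 3)) Set.univ {a 0, a 1},
          ∑ F₂ ∈ tJoins ((zdGraph 3).comap (Subtype.val : ↥(box 3 N) → Site 3)) Set.univ {a 2, a 3},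
            if (SimpleGraph.fromEdgeSet ((↑F₁ : Set (Sym2 ↥(box 3 N))) ∪ ↑F₂)).Reachable (a 0) (a 2)
            then Real.tanh (criticalBeta 3) ^ (F₁.card + F₂.card) else 0) := by
    intro l
    by_cases hl : 1 ≤ l
    · obtain ⟨c', hc', h⟩ := hper' l hl
      exact ⟨c', hc', fun _ => h⟩
    · exact ⟨1, one_pos, fun h => absurd h hl⟩
  choose cf hcf hN using hper''
  -- the crux's constant: the minimum of `c/6` and the per-scale constants at the scales `l ≤ l₁`
  have hne : (Finset.range (l₁ + 1)).Nonempty := ⟨0, by simp⟩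
  set cstar : ℝ := min (c / 2 / 3) ((Finset.range (l₁ + 1)).inf' hne cf) with hcstar
  have hcstar_pos : 0 < cstar := by
    refine lt_min (by positivity) ?_
    exact (Finset.lt_inf'_iff hne).2 fun l _ => hcf l
  have hcstar_le : cstar ≤ c / 2 / 3 := min_le_left _ _
  have hcstar_le' : ∀ l : ℕ, l ≤ l₁ → cstar ≤ cf l := fun l hl =>
    (min_le_right _ _).trans (Finset.inf'_le cf (by simpa [Nat.lt_succ_iff] using hl))
  refine ⟨cstar, hcstar_pos, fun l hl => ?_⟩
  have ht : 0 ≤ Real.tanh (criticalBeta 3) := tanh_criticalBeta_nonneg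
  by_cases hl₁ : l₁ ≤ l
  · obtain ⟨N₀, hN₀⟩ := hlarge l hl hl₁
    refine ⟨N₀, fun N hNN a ha => ?_⟩
    have h := hN₀ N hNN a ha
    have hZ : 0 ≤ loopO1PartitionFunction ((zdGraph 3).comap (Subtype.val : ↥(box 3 N) → Site 3))
          (Real.tanh (criticalBeta 3)) {a 0, a 1} *
        loopO1PartitionFunction ((zdGraph 3).comap (Subtype.val : ↥(box 3 N) → Site 3))
          (Real.tanh (criticalBeta 3)) {a 2, a 3} :=
      mul_nonneg (loopO1PartitionFunction_nonneg _ ht _) (loopO1PartitionFunction_nonneg _ ht _)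
    have hmono := mul_le_mul_of_nonneg_right hcstar_le hZ
    simp only
    linarith [hmono, h]
  · push Not at hl₁
    obtain ⟨N₀, hN₀⟩ := hN l hl
    refine ⟨N₀, fun N hNN a ha => ?_⟩
    have h := hN₀ N hNN a ha
    have hZ : 0 ≤ loopO1PartitionFunction ((zdGraph 3).comap (Subtype.val : ↥(box 3 N) → Site 3))
          (Real.tanh (criticalBeta 3)) {a 0, a 1} *
        loopO1PartitionFunction ((zdGraph 3).comap (Subtype.val : ↥(box 3 N) → Site 3))
          (Real.tanh (criticalBeta 3)) {a 2, a 3} :=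
      mul_nonneg (loopO1PartitionFunction_nonneg _ ht _) (loopO1PartitionFunction_nonneg _ ht _)
    have hmono := mul_le_mul_of_nonneg_right (hcstar_le' l hl₁.le) hZ
    simp only
    linarith [hmono, h]

end Summit.CriticalPhenomena.Ising3DConformalLimit.Cruxes.IndependentStrandsJoin.PinchToTetra

/-! ## The registered sub-goal `stub_limitUpgrade` -/

namespace Summit.CriticalPhenomena.Ising3DConformalLimit.Theorems

open Summit.CriticalPhenomena.Ising3DConformalLimit.Cruxes.IndependentStrandsJoin.PinchToTetra

/-- **Registered sub-goal `stub_limitUpgrade` of the crux `IndependentStrandsJoin`** (stmt-CriticalPhenomena-14625,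
lines `limit-upgrade-io` / `pinch-to-tetra`): existence of a non-degenerate pointwise scaling limit, tetrahedral
far merging along infinitely many scales and the per-scale crux imply the crux BY NAME
(`PinchToTetra.independentStrandsJoin_of_limit_io`). -/
theorem stub_limitUpgrade : LimitExists → TetraMergingIO → IndependentStrandsJoinPerScale → IndependentStrandsJoin :=
  independentStrandsJoin_of_limit_io

end Summit.CriticalPhenomena.Ising3DConformalLimit.Theorems

end
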